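import Mathlib
import Summits.Ventures.PercRepro.TriangleCapTwoTrianglesTwoBelowD

/-!
# PercRepro — THE REFINED FAR COUNT AROUND TWO TRIANGLES, PART A: double sums and the pair counts
(p3, gen 37; part 55)

For a set `S` of vertices write `degIn S x = |N(x) ∩ S|` and `Q = adjPairs D S` (the ordered adjacent pairs
inside `S`).  The deficit sum `Σ_p deficit(p) = Σ_z far(z)` is bounded below vertex by vertex and pair by pair:

* `adjPairs_le_far_add` — for every `z`, `Q ≤ far(z) + 2 Σ_{x ∈ N(z) ∩ S} degIn S x`: a pair inside `S` is far
  from `z` unless one of its ends is a neighbour of `z`, and those pairs number at most `2 Σ_{x ∈ N(z) ∩ S}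
  degIn S x`;
* `sum_far_eq_double` — the far count of the vertices of `S` is `Σ_{(x, y) adjacent} |S ∖ (N(x) ∪ N(y))|`, a
  double sum over all ordered pairs, which `double_sum_split` cuts into the four blocks of `S` and `Sᶜ`;
* `card_le_card_far_add` / `card_add_one_le_card_far_add` — `|S ∖ (N(x) ∪ N(y))| ≥ |S| − degIn S x − degIn S y`,
  and one more when `x, y` have a common neighbour in `S` (the third vertex of a triangle, `exists_third_of_clique`).
Part B assembles the four blocks into the far count around two triangles.
Axioms: standard.
-/

namespace PercRepro

namespace TriangleCap

namespace C047

open Finset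

variable {V : Type*} [Fintype V] [DecidableEq V]

omit [Fintype V] [DecidableEq V] in
/-- The degree of `x` into `S`: `|N(x) ∩ S|`. -/
def degIn (D : SimpleGraph V) [DecidableRel D.Adj] (S : Finset V) (x : V) : ℕ :=
  (S.filter (fun y => D.Adj x y)).card

omit [DecidableEq V] in
/-- A sum over the ordered adjacent pairs as a double sum over all vertices. -/
theorem sum_adjPairsAll_eq_double (D : SimpleGraph V) [DecidableRel D.Adj] (g : V × V → ℕ) :
    ∑ p ∈ adjPairsAll D, g p = ∑ x, ∑ y, if D.Adj x y then g (x, y) else 0 := by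
  unfold adjPairsAll
  rw [sum_filter, sum_product]

omit [DecidableEq V] in
/-- The far count of the vertices of `S`, as a double sum over the ordered adjacent pairs. -/
theorem sum_far_eq_double (D : SimpleGraph V) [DecidableRel D.Adj] (S : Finset V) :
    ∑ z ∈ S, far D z =
      ∑ x, ∑ y, if D.Adj x y then (S.filter (fun t => ¬ D.Adj x t ∧ ¬ D.Adj y t)).card else 0 := by
  have h : ∑ z ∈ S, far D z =
      ∑ p ∈ adjPairsAll D, (S.filter (fun t => ¬ D.Adj p.1 t ∧ ¬ D.Adj p.2 t)).card := by
    simp only [far, card_filter]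
    rw [sum_comm]
  rw [h, sum_adjPairsAll_eq_double]

/-- A double sum over all vertices splits into the four blocks of `S` and `Sᶜ`. -/
theorem double_sum_split (S : Finset V) (F : V → V → ℕ) :
    ∑ x, ∑ y, F x y = (∑ x ∈ S, ∑ y ∈ S, F x y) + (∑ x ∈ S, ∑ y ∈ Sᶜ, F x y) +
      ((∑ x ∈ Sᶜ, ∑ y ∈ S, F x y) + (∑ x ∈ Sᶜ, ∑ y ∈ Sᶜ, F x y)) := by
  have h1 : ∀ x, ∑ y, F x y = ∑ y ∈ S, F x y + ∑ y ∈ Sᶜ, F x y :=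
    fun x => (sum_add_sum_compl S _).symm
  rw [← sum_add_sum_compl S]
  simp only [h1, sum_add_distrib]

omit [Fintype V] [DecidableEq V] in
/-- `Σ_{x ∈ A} Σ_{y ∈ B} [x ~ y] · f x = Σ_{x ∈ A} degIn B x · f x`. -/
theorem double_sum_ite_left (D : SimpleGraph V) [DecidableRel D.Adj] (A B : Finset V) (f : V → ℕ) :
    (∑ x ∈ A, ∑ y ∈ B, if D.Adj x y then f x else 0) = ∑ x ∈ A, degIn D B x * f x := by
  apply sum_congr rfl
  intro x _
  rw [← sum_filter, sum_const, smul_eq_mul]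
  rfl

omit [Fintype V] [DecidableEq V] in
/-- `Σ_{x ∈ A} Σ_{y ∈ B} [x ~ y] · f y = Σ_{y ∈ B} degIn A y · f y`. -/
theorem double_sum_ite_right (D : SimpleGraph V) [DecidableRel D.Adj] (A B : Finset V) (f : V → ℕ) :
    (∑ x ∈ A, ∑ y ∈ B, if D.Adj x y then f y else 0) = ∑ y ∈ B, degIn D A y * f y := by
  rw [sum_comm]
  apply sum_congr rfl
  intro y _
  have : (∑ x ∈ A, if D.Adj x y then f y else 0) = ∑ x ∈ A, if D.Adj y x then f y else 0 := by
    apply sum_congr rfl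
    intro x _
    have h := D.adj_comm x y
    simp only [h]
  rw [this, ← sum_filter, sum_const, smul_eq_mul]
  rfl

omit [Fintype V] [DecidableEq V] in
/-- `Σ_{x ∈ A} Σ_{y ∈ B} [x ~ y] · f x y` as a sum over `y` then its neighbours in `A`. -/
theorem double_sum_ite_swap (D : SimpleGraph V) [DecidableRel D.Adj] (A B : Finset V) (f : V → V → ℕ) :
    (∑ x ∈ A, ∑ y ∈ B, if D.Adj x y then f x y else 0) =
      ∑ y ∈ B, ∑ x ∈ A.filter (fun x => D.Adj y x), f x y := by
  rw [sum_comm]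
  apply sum_congr rfl
  intro y _
  rw [sum_filter]
  apply sum_congr rfl
  intro x _
  have h := D.adj_comm x y
  simp only [h]

omit [Fintype V] [DecidableEq V] in
/-- The pairs inside `S` as a sum of the degrees into `S`. -/
theorem adjPairs_eq_sum_degIn (D : SimpleGraph V) [DecidableRel D.Adj] (S : Finset V) :
    adjPairs D S = ∑ x ∈ S, degIn D S x := by
  unfold adjPairs
  rw [card_filter, sum_product]
  apply sum_congr rfl
  intro x _
  unfold degIn
  rw [card_filter]

/-- **THE PAIRS INSIDE `S` AND A VERTEX `z`:** `Q ≤ far(z) + 2 Σ_{x ∈ N(z) ∩ S} degIn S x` — a pair inside `S`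
is far from `z` unless one of its ends is a neighbour of `z`. -/
theorem adjPairs_le_far_add (D : SimpleGraph V) [DecidableRel D.Adj] (S : Finset V) (z : V) :
    adjPairs D S ≤ far D z + 2 * ∑ x ∈ S.filter (fun x => D.Adj z x), degIn D S x := by
  set P := (S ×ˢ S).filter (fun p : V × V => D.Adj p.1 p.2) with hP
  clear_value P
  have hsub : P.filter (fun p => ¬ D.Adj p.1 z ∧ ¬ D.Adj p.2 z) ⊆
      (adjPairsAll D).filter (fun p => ¬ D.Adj p.1 z ∧ ¬ D.Adj p.2 z) := by
    intro p hp
    rw [mem_filter] at hp ⊢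
    refine ⟨?_, hp.2⟩
    rw [mem_adjPairsAll]
    have := hp.1
    rw [hP, mem_filter] at this
    exact this.2
  have h1 : (P.filter (fun p => ¬ D.Adj p.1 z ∧ ¬ D.Adj p.2 z)).card ≤ far D z := card_le_card hsub
  have h2 := card_filter_add_card_filter_not (s := P) (fun p => ¬ D.Adj p.1 z ∧ ¬ D.Adj p.2 z)
  have h3 : P.filter (fun p => ¬ (¬ D.Adj p.1 z ∧ ¬ D.Adj p.2 z)) ⊆
      P.filter (fun p => D.Adj p.1 z) ∪ P.filter (fun p => D.Adj p.2 z) := by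
    intro p hp
    rw [mem_filter] at hp
    rw [mem_union, mem_filter, mem_filter]
    by_cases h : D.Adj p.1 z
    · exact Or.inl ⟨hp.1, h⟩
    · refine Or.inr ⟨hp.1, ?_⟩
      by_contra h'
      exact hp.2 ⟨h, h'⟩
  have h4 := card_le_card h3
  have h5 := card_union_le (P.filter (fun p => D.Adj p.1 z)) (P.filter (fun p => D.Adj p.2 z))
  -- the pairs whose first end is a neighbour of `z`
  have h6 : (P.filter (fun p => D.Adj p.1 z)).card = ∑ x ∈ S.filter (fun x => D.Adj z x), degIn D S x := by
    rw [hP, filter_filter, card_filter, sum_product]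
    rw [sum_filter]
    apply sum_congr rfl
    intro x _
    by_cases hxz : D.Adj z x
    · have hxz' : D.Adj x z := hxz.symm
      simp only [hxz, hxz', and_true, if_true]
      unfold degIn
      rw [card_filter]
    · have hxz' : ¬ D.Adj x z := fun h => hxz h.symm
      simp only [hxz, hxz', and_false, if_false, sum_const_zero]
  -- the pairs whose second end is a neighbour of `z`
  have h7 : (P.filter (fun p => D.Adj p.2 z)).card = ∑ x ∈ S.filter (fun x => D.Adj z x), degIn D S x := by
    rw [hP, filter_filter, card_filter, sum_product, sum_comm]
    rw [sum_filter]
    apply sum_congr rfl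
    intro y _
    by_cases hyz : D.Adj z y
    · have hyz' : D.Adj y z := hyz.symm
      simp only [hyz, hyz', and_true, if_true]
      unfold degIn
      rw [card_filter]
      apply sum_congr rfl
      intro x _
      have h := D.adj_comm x y
      simp only [h]
    · have hyz' : ¬ D.Adj y z := fun h => hyz h.symm
      simp only [hyz, hyz', and_false, if_false, sum_const_zero]
  have hQ : adjPairs D S = P.card := by rw [hP]; rfl
  omega

omit [Fintype V] in
/-- For any two vertices `x, y`: `|S| ≤ |S ∖ (N(x) ∪ N(y))| + degIn S x + degIn S y`. -/
theorem card_le_card_far_add (D : SimpleGraph V) [DecidableRel D.Adj] (S : Finset V) (x y : V) :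
    S.card ≤ (S.filter (fun t => ¬ D.Adj x t ∧ ¬ D.Adj y t)).card + degIn D S x + degIn D S y := by
  have h1 : S.filter (fun t => ¬ D.Adj x t ∧ ¬ D.Adj y t) =
      S \ (S.filter (fun t => D.Adj x t) ∪ S.filter (fun t => D.Adj y t)) := by
    ext t
    simp only [mem_filter, mem_sdiff, mem_union]
    tauto
  have h2 : (S.filter (fun t => D.Adj x t) ∪ S.filter (fun t => D.Adj y t)) ⊆ S :=
    union_subset (filter_subset _ _) (filter_subset _ _)
  have h3 := card_sdiff_add_card_eq_card h2
  have h4 := card_union_le (S.filter (fun t => D.Adj x t)) (S.filter (fun t => D.Adj y t))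
  unfold degIn
  rw [h1]
  omega

omit [Fintype V] in
/-- With a common neighbour `t ∈ S`: `|S| + 1 ≤ |S ∖ (N(x) ∪ N(y))| + degIn S x + degIn S y`. -/
theorem card_add_one_le_card_far_add (D : SimpleGraph V) [DecidableRel D.Adj] (S : Finset V) {x y t : V}
    (ht : t ∈ S) (htx : D.Adj x t) (hty : D.Adj y t) :
    S.card + 1 ≤ (S.filter (fun t => ¬ D.Adj x t ∧ ¬ D.Adj y t)).card + degIn D S x + degIn D S y := by
  have h1 : S.filter (fun t => ¬ D.Adj x t ∧ ¬ D.Adj y t) =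
      S \ (S.filter (fun t => D.Adj x t) ∪ S.filter (fun t => D.Adj y t)) := by
    ext t
    simp only [mem_filter, mem_sdiff, mem_union]
    tauto
  have h2 : (S.filter (fun t => D.Adj x t) ∪ S.filter (fun t => D.Adj y t)) ⊆ S :=
    union_subset (filter_subset _ _) (filter_subset _ _)
  have h3 := card_sdiff_add_card_eq_card h2
  have h4 := card_union_add_card_inter (S.filter (fun t => D.Adj x t)) (S.filter (fun t => D.Adj y t))
  have h5 : 1 ≤ ((S.filter (fun t => D.Adj x t)) ∩ (S.filter (fun t => D.Adj y t))).card := by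
    apply card_pos.mpr
    exact ⟨t, by simp only [mem_inter, mem_filter]; exact ⟨⟨ht, htx⟩, ⟨ht, hty⟩⟩⟩
  unfold degIn
  rw [h1]
  omega

omit [Fintype V] in
/-- In a clique `T` of three vertices, `|T ∩ N(x)| = 2` for `x ∈ T`. -/
theorem degIn_self_of_clique (D : SimpleGraph V) [DecidableRel D.Adj] {T : Finset V} (hT : T.card = 3)
    (hcl : ∀ x ∈ T, ∀ y ∈ T, x ≠ y → D.Adj x y) {x : V} (hx : x ∈ T) : degIn D T x = 2 := by
  unfold degIn
  have : T.filter (fun y => D.Adj x y) = T.erase x := by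
    ext y
    simp only [mem_filter, mem_erase]
    constructor
    · rintro ⟨hy, hxy⟩
      exact ⟨hxy.ne.symm, hy⟩
    · rintro ⟨hyx, hy⟩
      exact ⟨hy, hcl x hx y hy (Ne.symm hyx)⟩
  rw [this, card_erase_of_mem hx, hT]

omit [Fintype V] in
/-- Two distinct vertices of a three-clique have a third vertex of it as a common neighbour. -/
theorem exists_third_of_clique (D : SimpleGraph V) [DecidableRel D.Adj] {T : Finset V} (hT : T.card = 3)
    (hcl : ∀ x ∈ T, ∀ y ∈ T, x ≠ y → D.Adj x y) {x y : V} (hx : x ∈ T) (hy : y ∈ T) (hxy : x ≠ y) :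
    ∃ t ∈ T, D.Adj x t ∧ D.Adj y t := by
  have h1 : ((T.erase x).erase y).card = 1 := by
    rw [card_erase_of_mem (mem_erase.mpr ⟨Ne.symm hxy, hy⟩), card_erase_of_mem hx, hT]
  obtain ⟨t, ht⟩ := card_pos.mp (by omega : 0 < ((T.erase x).erase y).card)
  rw [mem_erase, mem_erase] at ht
  exact ⟨t, ht.2.2, hcl x hx t ht.2.2 (Ne.symm ht.2.1), hcl y hy t ht.2.2 (Ne.symm ht.1)⟩

end C047

end TriangleCap

end PercRepro
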